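import Mathlib.RingTheory.Nakayama
import Mathlib.RingTheory.Finiteness.Nakayama
import Mathlib.RingTheory.Jacobson.Ideal
import Mathlib.RingTheory.LocalRing.MaximalIdeal.Basic
import Mathlib.RingTheory.Ideal.Quotient.Operations
import Mathlib.RingTheory.Localization.Away.Basic
import HarnessLib

/-!
# [OURS · L1 W4.5(b)] EL♮ `EquisingularLiftNat` (stmt-ResolutionOfSingularities-20038), line `sections` —
# helper H-L0a `pushdown_lift_of_nose`: the ALGEBRAIC CORE (Nakayama pushdown)

Helper file `--supports stmt-ResolutionOfSingularities-20038` for the research stub `stub_elnat_three`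
(res-L1-w45b-plan-1 CRUX-PLAN v3.0.1 §1.3 «PUSHDOWN LEMMA (N ⇒ lift of Σ itself)», helper list §4 «H-L0a
`pushdown_lift_of_nose` (§1.3 pushdown lemma; algebraic core …)»; CHAIN w45b v6.2 §3 «H-L0a/b free»). NOT a statement of
any manuscript; OURS, elementary commutative algebra (Nakayama's lemma), no geometry is asserted here.

## The pushdown lemma and why no genus bookkeeping is needed

Setting of CRUX-PLAN v3 §1.3: `O` a complete DVR with uniformiser `ϖ` and residue field `k`, `P_i → ℙ³_O` a composite of
blow-ups in regular centres, `Σ ⊂ ℙ³_k` a smooth irreducible curve whose strict transform `Σ_i ⊂ P_{i,k}` is `≅ Σ` (all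
earlier centres met `Σ` in finitely many points), and `C ⊂ P_i` a regular `O`-flat closed subscheme with special fibre
`C_k = Σ_i` (the «nose» case (N)). Put `C̄ :=` scheme-theoretic image of `C` in `ℙ³_O`. The printed 6-line argument
compares `g(C_K)`, `p_a(C̄_K)`, `p_a(C̄_k)` and concludes `δ + ℓ = 0`. The present file replaces it by NAKAYAMA:

* `C → C̄` is proper and quasi-finite (a fibre over a closed point `y ∈ C̄` lies in `C_k = Σ_i ≅ Σ`, one point), hence
  FINITE; `𝒪_{C̄} → π_* 𝒪_C` is injective (scheme-theoretic image); and `C_k = Σ_i → C̄_k` is a CLOSED IMMERSION (its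
  composite with `C̄_k ⊂ ℙ³_k` is the closed immersion `Σ ⊂ ℙ³_k`).
* So at a closed point `y ∈ C̄_k` with `x ∈ C` above it: `B := 𝒪_{C̄,y} ↪ A := 𝒪_{C,x}` is module-finite and
  `B/ϖB ↠ A/ϖA`, i.e. `A = B + ϖA` with `ϖ ∈ rad B`; Nakayama for the finite `B`-module `A` (or `A/B`) gives `A = B`
  (`algebraMap_surjective_of_finite_of_le_jacobson`, `…_of_isLocalRing`, principal and bijective forms below).
* Hence `C ≅ C̄` over a neighbourhood of `C̄_k` (non-local form `exists_sub_one_mem_and_smul_mem_range_of_finite`: one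
  `r ≡ 1 (mod ϖ)` with `B_r = A_r` on each affine piece), and over all of `C̄` because `C̄` is proper over `Spec O` (a
  non-empty closed subset of `C̄` meets `C̄_k`). So `C̄` is regular, `O`-smooth, `C̄_k = Σ`: an embedded lift of `Σ`, and
  `ℓ = δ = 0` come for free — no `p_a`, no cohomology-and-base-change.

What is HERE (kernel): the ring-theoretic core in four forms (Jacobson-radical form, local form, principal `ϖ`-form,
non-local «`r ≡ 1 mod I`» form, localised `B_r ≅ A_r`) + the bijective / quotient transports a consumer needs to move
regularity and the special fibre from `C` to `C̄`; everything is `def`-free. What is NOT here: the scheme-level packaging («finite + schematically dominant +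
special-fibre base change a closed immersion ⇒ isomorphism near the fibre») and the three geometric inputs listed in the
first bullet — they belong to the consumer's model of the blow-up tower (route vocabulary `IsBlowup`, `Proj … O`).
References for the algebra: Atiyah–Macdonald Prop. 2.6/Cor. 2.7; Matsumura Thm. 2.2; Stacks 00DV. [folklore]
-/

set_option linter.dupNamespace false -- mandated namespace `Summit.<Summit>.<Problem>` of this single-conjunct summit

namespace Summit.ResolutionOfSingularities.ResolutionOfSingularities.Cruxes.EquisingularLiftNat.Sections

variable {B A : Type*} [CommRing B] [CommRing A] [Algebra B A]

/-! ## The hypothesis «`B → A/IA` is onto», unfolded -/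

/-- If `B → A → A ⧸ I·A` is surjective then `A = (image of B) + I·A` as `B`-submodules of `A`. [folklore] -/
theorem top_le_range_sup_smul_top_of_surjective_mod (I : Ideal B)
    (h : Function.Surjective ((Ideal.Quotient.mk (I.map (algebraMap B A))).comp (algebraMap B A))) :
    (⊤ : Submodule B A) ≤ LinearMap.range (Algebra.linearMap B A) ⊔ I • ⊤ := by
  intro a _
  obtain ⟨b, hb⟩ := h (Ideal.Quotient.mk (I.map (algebraMap B A)) a)
  have hmem : a - algebraMap B A b ∈ I.map (algebraMap B A) := by
    rw [← Ideal.Quotient.eq, ← hb]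
    rfl
  rw [Ideal.smul_top_eq_map]
  exact Submodule.mem_sup.mpr
    ⟨algebraMap B A b, LinearMap.mem_range.mpr ⟨b, rfl⟩, a - algebraMap B A b, hmem, by abel⟩

/-- Conversely, surjectivity of `B → A` trivially gives surjectivity of `B → A ⧸ I·A`. [folklore] -/
theorem surjective_mod_of_surjective (I : Ideal B) (h : Function.Surjective (algebraMap B A)) :
    Function.Surjective ((Ideal.Quotient.mk (I.map (algebraMap B A))).comp (algebraMap B A)) :=
  Ideal.Quotient.mk_surjective.comp h

/-- The principal form of the hypothesis: if every `a : A` is `b + ϖ·c` with `b ∈ B`, then `B → A ⧸ ϖA` is onto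
(`I = (ϖ)`). [folklore] -/
theorem surjective_mod_span_singleton_of_forall_exists (ϖ : B)
    (h : ∀ a : A, ∃ b : B, ∃ c : A, a = algebraMap B A b + algebraMap B A ϖ * c) :
    Function.Surjective
      ((Ideal.Quotient.mk ((Ideal.span {ϖ}).map (algebraMap B A))).comp (algebraMap B A)) := by
  intro q
  obtain ⟨a, rfl⟩ := Ideal.Quotient.mk_surjective q
  obtain ⟨b, c, habc⟩ := h a
  refine ⟨b, ?_⟩
  rw [RingHom.comp_apply, Ideal.Quotient.eq, Ideal.map_span, Set.image_singleton, habc, sub_add_cancel_left,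
    Ideal.neg_mem_iff]
  exact Ideal.mul_mem_right _ _ (Ideal.subset_span rfl)

/-! ## Nakayama pushdown: local forms -/

/-- **Pushdown, Jacobson form.** `A` a module-finite `B`-algebra, `I ≤ Jac(B)`, and `B → A ⧸ I·A` onto `⇒` `B → A`
onto. (Nakayama `Submodule.le_of_le_smul_of_le_jacobson_bot` for the f.g. `B`-module `A` and its submodule `image B`.)
[folklore] -/
theorem algebraMap_surjective_of_finite_of_le_jacobson [Module.Finite B A] (I : Ideal B)
    (hI : I ≤ (⊥ : Ideal B).jacobson)
    (h : Function.Surjective ((Ideal.Quotient.mk (I.map (algebraMap B A))).comp (algebraMap B A))) :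
    Function.Surjective (algebraMap B A) := by
  have htop : (⊤ : Submodule B A) ≤ LinearMap.range (Algebra.linearMap B A) :=
    Submodule.le_of_le_smul_of_le_jacobson_bot Module.Finite.fg_top hI
      (top_le_range_sup_smul_top_of_surjective_mod I h)
  intro a
  obtain ⟨b, hb⟩ := LinearMap.mem_range.mp (htop (Submodule.mem_top (x := a)))
  exact ⟨b, hb⟩

/-- **Pushdown, local form.** `B` local, `A` a module-finite `B`-algebra, `I ≠ B`, and `B → A ⧸ I·A` onto `⇒` `B → A`
onto. [folklore] -/
theorem algebraMap_surjective_of_finite_of_isLocalRing [IsLocalRing B] [Module.Finite B A] (I : Ideal B)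
    (hI : I ≠ ⊤)
    (h : Function.Surjective ((Ideal.Quotient.mk (I.map (algebraMap B A))).comp (algebraMap B A))) :
    Function.Surjective (algebraMap B A) :=
  algebraMap_surjective_of_finite_of_le_jacobson I
    ((IsLocalRing.le_maximalIdeal hI).trans (IsLocalRing.maximalIdeal_le_jacobson ⊥)) h

/-- **Pushdown, principal form** (the shape used for `𝒪_{C̄,y} ⊆ 𝒪_{C,x}` with the uniformiser `ϖ`): `A` module-finite
over `B`, `ϖ ∈ Jac(B)` (e.g. `B` local and `ϖ` a non-unit), and every `a : A` of the form `b + ϖ·c` `⇒` `B → A` onto.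
[folklore] -/
theorem algebraMap_surjective_of_finite_of_forall_exists_add_mul [Module.Finite B A] (ϖ : B)
    (hϖ : ϖ ∈ (⊥ : Ideal B).jacobson)
    (h : ∀ a : A, ∃ b : B, ∃ c : A, a = algebraMap B A b + algebraMap B A ϖ * c) :
    Function.Surjective (algebraMap B A) :=
  algebraMap_surjective_of_finite_of_le_jacobson (Ideal.span {ϖ})
    ((Ideal.span_singleton_le_iff_mem _).mpr hϖ) (surjective_mod_span_singleton_of_forall_exists ϖ h)

/-- **Pushdown, bijective form.** If moreover `B → A` is injective (the «scheme-theoretic image» input), it is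
bijective. [folklore] -/
theorem algebraMap_bijective_of_finite_of_le_jacobson [Module.Finite B A] (I : Ideal B)
    (hI : I ≤ (⊥ : Ideal B).jacobson) (hinj : Function.Injective (algebraMap B A))
    (h : Function.Surjective ((Ideal.Quotient.mk (I.map (algebraMap B A))).comp (algebraMap B A))) :
    Function.Bijective (algebraMap B A) :=
  ⟨hinj, algebraMap_surjective_of_finite_of_le_jacobson I hI h⟩

/-- Transport of the special fibre: under the pushdown hypotheses the induced map `B ⧸ I → A ⧸ I·A` is bijective
(so, in the application, `𝒪_{C̄_k,y} ≅ 𝒪_{C_k,x} = 𝒪_{Σ,x}`; a consumer packages `RingEquiv.ofBijective` as needed —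
this file stays `def`-free). [folklore] -/
theorem quotientMap_bijective_of_finite_of_le_jacobson [Module.Finite B A] (I : Ideal B)
    (hI : I ≤ (⊥ : Ideal B).jacobson) (hinj : Function.Injective (algebraMap B A))
    (h : Function.Surjective ((Ideal.Quotient.mk (I.map (algebraMap B A))).comp (algebraMap B A))) :
    Function.Bijective (Ideal.quotientMap (I.map (algebraMap B A)) (algebraMap B A) Ideal.le_comap_map) := by
  have hsurj := algebraMap_surjective_of_finite_of_le_jacobson I hI h
  refine ⟨Ideal.quotientMap_injective' (le_of_eq ?_), Ideal.quotientMap_surjective hsurj⟩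
  rw [Ideal.comap_map_of_surjective _ hsurj, ← RingHom.ker_eq_comap_bot,
    (RingHom.injective_iff_ker_eq_bot _).mp hinj, sup_bot_eq]

/-! ## Nakayama pushdown: non-local form («isomorphism over a neighbourhood `D(r) ⊇ V(I)`») -/

/-- **Pushdown, non-local form.** `A` a module-finite `B`-algebra with `B → A ⧸ I·A` onto (no radical hypothesis).
Then some `r ≡ 1 (mod I)` multiplies all of `A` into the image of `B` (Nakayama with an element,
`Submodule.exists_sub_one_mem_and_smul_eq_zero_of_fg_of_le_smul`, applied to the f.g. `B`-module `A ⧸ image B`).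
Geometrically: `Spec A → Spec B` is an isomorphism over the open `D(r)`, which contains `V(I)`. [folklore] -/
theorem exists_sub_one_mem_and_smul_mem_range_of_finite [Module.Finite B A] (I : Ideal B)
    (h : Function.Surjective ((Ideal.Quotient.mk (I.map (algebraMap B A))).comp (algebraMap B A))) :
    ∃ r : B, r - 1 ∈ I ∧ ∀ a : A, r • a ∈ LinearMap.range (Algebra.linearMap B A) := by
  set N : Submodule B A := LinearMap.range (Algebra.linearMap B A) with hN
  have hle : (⊤ : Submodule B (A ⧸ N)) ≤ I • ⊤ := by
    rintro x -
    obtain ⟨a, rfl⟩ := N.mkQ_surjective x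
    obtain ⟨n, hn, m, hm, hnm⟩ :=
      Submodule.mem_sup.mp (top_le_range_sup_smul_top_of_surjective_mod I h (Submodule.mem_top (x := a)))
    have hn0 : N.mkQ n = 0 := (Submodule.Quotient.mk_eq_zero N).mpr hn
    have hm' : N.mkQ m ∈ (I • (⊤ : Submodule B A)).map N.mkQ := Submodule.mem_map_of_mem hm
    rw [Submodule.map_smul''] at hm'
    rw [← hnm, map_add, hn0, zero_add]
    exact Submodule.smul_mono le_rfl le_top hm'
  obtain ⟨r, hr1, hr⟩ :=
    Submodule.exists_sub_one_mem_and_smul_eq_zero_of_fg_of_le_smul I ⊤ Module.Finite.fg_top hle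
  refine ⟨r, hr1, fun a => ?_⟩
  have h0 : r • N.mkQ a = 0 := hr _ Submodule.mem_top
  rwa [← map_smul, Submodule.mkQ_apply, Submodule.Quotient.mk_eq_zero] at h0

/-- With such an `r`, the localised structure map `B_r → A_r` is onto (`IsLocalization.Away.map_surjective_iff`).
[folklore] -/
theorem awayMap_surjective_of_smul_mem_range (r : B)
    (hr : ∀ a : A, r • a ∈ LinearMap.range (Algebra.linearMap B A))
    (Bᵣ Aᵣ : Type*) [CommRing Bᵣ] [Algebra B Bᵣ] [IsLocalization.Away r Bᵣ]
    [CommRing Aᵣ] [Algebra A Aᵣ] [IsLocalization.Away (algebraMap B A r) Aᵣ] :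
    Function.Surjective (IsLocalization.Away.map Bᵣ Aᵣ (algebraMap B A) r) := by
  rw [IsLocalization.Away.map_surjective_iff]
  intro a
  obtain ⟨b, hb⟩ := LinearMap.mem_range.mp (hr a)
  refine ⟨b, 1, ?_⟩
  rw [pow_one, ← Algebra.smul_def, ← hb]
  rfl

/-- … and it is injective as soon as `B → A` is (`IsLocalization.Away.map_injective_iff`); together: `B_r ≅ A_r`, i.e.
`Spec A → Spec B` is an isomorphism over `D(r) ⊇ V(I)`. [folklore] -/
theorem awayMap_bijective_of_injective_of_smul_mem_range (r : B) (hinj : Function.Injective (algebraMap B A))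
    (hr : ∀ a : A, r • a ∈ LinearMap.range (Algebra.linearMap B A))
    (Bᵣ Aᵣ : Type*) [CommRing Bᵣ] [Algebra B Bᵣ] [IsLocalization.Away r Bᵣ]
    [CommRing Aᵣ] [Algebra A Aᵣ] [IsLocalization.Away (algebraMap B A r) Aᵣ] :
    Function.Bijective (IsLocalization.Away.map Bᵣ Aᵣ (algebraMap B A) r) := by
  refine ⟨?_, awayMap_surjective_of_smul_mem_range r hr Bᵣ Aᵣ⟩
  rw [IsLocalization.Away.map_injective_iff]
  intro a ha
  exact ⟨0, by rw [pow_zero, one_mul]; exact hinj (by rw [ha, map_zero])⟩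

/-- **Pushdown, non-local form, packaged**: `A` module-finite over `B`, `B → A` injective and onto modulo `I` `⇒` there is
`r ≡ 1 (mod I)` with `B_r → A_r` bijective. For the geometric application: on each affine piece `Spec B` of `C̄` meeting
the special fibre `V(ϖ)`, `C → C̄` is an isomorphism over `D(r) ⊇ V(ϖ) ∩ Spec B`; properness of `C̄ → Spec O` then gives
`C ≅ C̄` globally. [folklore] -/
theorem exists_awayMap_bijective_of_finite (I : Ideal B) [Module.Finite B A]
    (hinj : Function.Injective (algebraMap B A))
    (h : Function.Surjective ((Ideal.Quotient.mk (I.map (algebraMap B A))).comp (algebraMap B A))) :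
    ∃ r : B, r - 1 ∈ I ∧
      Function.Bijective (IsLocalization.Away.map (Localization.Away r)
        (Localization.Away (algebraMap B A r)) (algebraMap B A) r) := by
  obtain ⟨r, hr1, hr⟩ := exists_sub_one_mem_and_smul_mem_range_of_finite I h
  exact ⟨r, hr1, awayMap_bijective_of_injective_of_smul_mem_range r hinj hr _ _⟩

end Summit.ResolutionOfSingularities.ResolutionOfSingularities.Cruxes.EquisingularLiftNat.Sections
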